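import Summits.Ventures.HodgeRepro2.T5QuadraticCensusFinite
import Summits.Ventures.HodgeRepro2.T5SplitPlaceLocalDegree

/-!
# T5QuadraticSplitLocal — at a split place of the census, `E ⊗_F F_v = F_v × F_v`:
# both local degrees are `1` and `F_v → E_w` is bijective (N3.10.2 from the Legendre symbol)

Tier-5 kernel support (seat p8, blind lane; sub-step N3).  T5-176 reads «`v` splits in `K(√d)`»
off `d` being a square modulo `v` (for `4d ∉ v`); T5-161 gives, for two distinct places `w ≠ w'`
over `v` in a quadratic `L/K`, `[L_w : K_v] = 1` and `K_v → L_w` bijective.  Composed: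

* `exists_ne_liesOver_bijective_of_isSquare` — for `4d ∉ v` and `d` a square modulo `v`, there are
  `w₁ ≠ w₂` over `v` with `K_v → L_{w₁}` and `K_v → L_{w₂}` bijective and both local degrees `1`
  (the record's N3.10.2 «`E ⊗_F F_v = F_v × F_v`» at every split place of the census);
* `exists_finite_split_census` — with the `d` of T5-177 and the finite exceptional set of T5-181:
  outside a finite set, `d` a square modulo `v` ⇒ the split local picture.

No `sorry`, no axiom beyond `propext`, `Classical.choice`, `Quot.sound`.
-/

namespace Summit.Ventures.HodgeRepro2.T5QuadraticSplitLocal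

open NumberField IsDedekindDomain HeightOneSpectrum

variable {K : Type*} [Field K] [NumberField K] {L : Type*} [Field L] [NumberField L] [Algebra K L]
  {x : 𝓞 L} {d : 𝓞 K} (v : HeightOneSpectrum (𝓞 K))

/-- **The split local picture from the Legendre symbol**: for `4d ∉ v` and `d` a square modulo
`v`, two distinct places `w₁ ≠ w₂` of `L` over `v` with `K_v → L_{w_i}` bijective and
`[L_{w_i} : K_v] = 1`. -/
theorem exists_ne_liesOver_bijective_of_isSquare (h2 : Module.finrank K L = 2)
    (hx : x * x = algebraMap (𝓞 K) (𝓞 L) d) (hx' : x ∉ Set.range (algebraMap (𝓞 K) (𝓞 L)))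
    (hv : 4 * d ∉ v.asIdeal) (hd : IsSquare (Ideal.Quotient.mk v.asIdeal d)) :
    ∃ w₁ w₂ : HeightOneSpectrum (𝓞 L), w₁ ≠ w₂ ∧
      ∃ (_ : w₁.asIdeal.LiesOver v.asIdeal) (_ : w₂.asIdeal.LiesOver v.asIdeal),
        Function.Bijective (algebraMap (v.adicCompletion K) (w₁.adicCompletion L)) ∧
        Function.Bijective (algebraMap (v.adicCompletion K) (w₂.adicCompletion L)) ∧
        Module.finrank (v.adicCompletion K) (w₁.adicCompletion L) = 1 ∧
        Module.finrank (v.adicCompletion K) (w₂.adicCompletion L) = 1 := by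
  obtain ⟨w₁, w₂, hne, h₁, h₂⟩ :=
    T5QuadraticSplitRamified.exists_ne_liesOver_of_isSquare v h2 hx hx' hv hd
  haveI := h₁
  haveI := h₂
  exact ⟨w₁, w₂, hne, h₁, h₂,
    T5SplitPlaceLocalDegree.bijective_algebraMap_adicCompletion_of_ne v w₁ w₂ h2 hne,
    T5SplitPlaceLocalDegree.bijective_algebraMap_adicCompletion_of_ne v w₂ w₁ h2 hne.symm,
    T5SplitPlaceLocalDegree.finrank_adicCompletion_eq_one_of_ne v w₁ w₂ h2 hne,
    T5SplitPlaceLocalDegree.finrank_adicCompletion_eq_one_of_ne v w₂ w₁ h2 hne.symm⟩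

/-- For every quadratic `L/K`: with the `d` of T5-177, outside the finite set `{v : 4d ∈ v}`,
`d` a square modulo `v` gives the split local picture `L ⊗_K K_v = K_v × K_v`. -/
theorem exists_finite_split_census (h2 : Module.finrank K L = 2) :
    ∃ (d : 𝓞 K) (S : Set (HeightOneSpectrum (𝓞 K))), S.Finite ∧
      ∀ v ∉ S, IsSquare (Ideal.Quotient.mk v.asIdeal d) →
        ∃ w₁ w₂ : HeightOneSpectrum (𝓞 L), w₁ ≠ w₂ ∧
          ∃ (_ : w₁.asIdeal.LiesOver v.asIdeal) (_ : w₂.asIdeal.LiesOver v.asIdeal),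
            Function.Bijective (algebraMap (v.adicCompletion K) (w₁.adicCompletion L)) ∧
            Function.Bijective (algebraMap (v.adicCompletion K) (w₂.adicCompletion L)) ∧
            Module.finrank (v.adicCompletion K) (w₁.adicCompletion L) = 1 ∧
            Module.finrank (v.adicCompletion K) (w₂.adicCompletion L) = 1 := by
  obtain ⟨x, d, hx, hx'⟩ := T5QuadraticGenerator.exists_sq_eq_algebraMap h2
  exact ⟨d, {v | 4 * d ∈ v.asIdeal}, T5QuadraticCensusFinite.finite_setOf_four_mul_mem hx hx',
    fun v hv hd => exists_ne_liesOver_bijective_of_isSquare v h2 hx hx' hv hd⟩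

end Summit.Ventures.HodgeRepro2.T5QuadraticSplitLocal
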